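import Literature.NumberTheory.ConnesConsani2021.ScalingOperator
import HarnessLib

/-!
# Connes–Consani 2021, Prop. 2.2 (iii) discharge track (R49), kernel side, step (k-1):
# the integral kernel of the scaling operator `ϑ(g)` on `L²(ℝ)` (RH-FREE)

LABEL (line 1): **RH-FREE corpus literature** (a change of variables).  A. Connes, C. Consani, *Weil
positivity and trace formula, the archimedean place*, Selecta Math. (N.S.) 27 (2021) 77 = arXiv:2006.13771
[bib: `ConnesConsani2021`], §1 Lemma 1.1 (= arXiv Lemma 4, p. 7: operators `(Tξ)(x) = ∫ k(x,y)ξ(y)dy`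
and their kernels in the variable `λ`), §4 eq. (40) p. 15 (`(ϑ(λ)ξ)(v) = λ^{-1/2}ξ(λ⁻¹v)`), proof of
Prop. 2.2 (iii) p. 10 (`ϑ(f) = ∫ f(ρ⁻¹)ϑ(ρ⁻¹)d*ρ` as an operator with kernel).

Cell `rh-crit`, sub-cell `cc/`, seat t1 — lead writer of the R49 discharge track of the named fact
`CC2021_prop_2_2_iii` (`SchwartzKernels.lean`); plan of record: `cc/drafts/t1-prop22iii-PLAN.md`.  This
module is step **(k-1)** of that plan: in the conventions of `ScalingOperator.lean`
(`(ϑ(e^τ)η)(v) = e^{−τ/2} η(e^{−τ}v)`, `ϑ(g) = ∫ g(τ) ϑ(e^τ) dτ` for an additive test function `g`), the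
substitution `y = e^{−τ}v` (for `v ≠ 0`) turns the `τ`-integral into an integral operator in `y`:

  `∫ g(τ) e^{−τ/2} η(e^{−τ}v) dτ = ∫ k_g(v,y) η(y) dy`,  `k_g(v,y) = 1_{vy>0} · g(log(v/y)) · (vy)^{−1/2}`

(`scalingKernel`, `integral_scalingKernel_mul`; integrability transfers: `integrable_scalingKernel_mul_iff`),
and this IS the action of the bounded operator `scalingOp g` on `L²(ℝ)` almost everywhere
(`scalingOp_coeFn_eq_integral`, step k-1b: equal integrals over every set of finite measure — duality with
indicators, `inner_scalingOp`, Fubini — and `ae_integrable_scalingKernel_mul`: a.e. slice is integrable);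
the symmetrised kernel `k_g^{ev}(x,y) = ½(k_g(x,y) + k_g(−x,y)) = ½ g(log(|x|/|y|)) |xy|^{−1/2}`
(`evenScalingKernel`, `evenScalingKernel_eq`) is the kernel of the even part `x ↦ ½((ϑ(g)η)(x) + (ϑ(g)η)(−x))`
(`scalingOp_coeFn_even_part`, step k-2a).  The kernel `k_g` is homogeneous of degree `−1`, so `ϑ(g)` itself
is not Hilbert–Schmidt; the HS factor of the plan is `𝐏₀₁ ∘ 𝐏₁₀ ∘ ϑ(g)` (steps k-2 … k-4, not in this
file).  Two definitions with bodies (`scalingKernel`, `evenScalingKernel`), no named fact, no instance, no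
`sorry`.
bears_on: W-C/W-P (apex (A), K1 boundary fact `CC2021_prop_2_2_iii`).  WHAT THIS IS NOT: any claim about
RH — nothing in this file bears on the truth of RH.

## References
* A. Connes, C. Consani, *Weil positivity and trace formula, the archimedean place*, Selecta Math. (N.S.)
  27 (2021), Paper No. 77 (arXiv:2006.13771), §1 Lemma 1.1 p. 7, §4 eq. (40) p. 15, Prop. 2.2 (iii) p. 10.
  [ConnesConsani2021]
-/

noncomputable section

open MeasureTheory Set Complex Filter
open scoped Real ComplexConjugate

namespace Literature.NumberTheory.ConnesConsani2021

variable {g : ℝ → ℂ}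

/-- **The integral kernel of `ϑ(g)`**: `k_g(v,y) := g(log(v/y)) · (vy)^{−1/2}` if `vy > 0`, and `0`
otherwise — the Schwartz kernel, in the variable `y = e^{−τ}v`, of the operator
`ϑ(g) = ∫ g(τ) ϑ(e^τ) dτ`, `(ϑ(e^τ)η)(v) = e^{−τ/2}η(e^{−τ}v)` (§4 eq. (40); the operators of §1 are given
by such kernels, Lemma 1.1). [cite: ConnesConsani2021, §4 eq. (40) p. 15; §1 Lemma 1.1 p. 7 (arXiv Lemma 4); Prop. 2.2 (iii) proof p. 10] -/
def scalingKernel (g : ℝ → ℂ) (v y : ℝ) : ℂ :=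
  if 0 < v * y then g (Real.log (v / y)) * ((Real.sqrt (v * y))⁻¹ : ℝ) else 0

/-- Off the quadrants `vy > 0` the kernel vanishes. [cite: ConnesConsani2021, §4 eq. (40) p. 15] -/
theorem scalingKernel_of_not_pos {v y : ℝ} (h : ¬ 0 < v * y) : scalingKernel g v y = 0 := by
  simp [scalingKernel, h]

/-- On `vy > 0` the kernel is `g(log(v/y)) (vy)^{−1/2}`. [cite: ConnesConsani2021, §4 eq. (40) p. 15] -/
theorem scalingKernel_of_pos {v y : ℝ} (h : 0 < v * y) :
    scalingKernel g v y = g (Real.log (v / y)) * ((Real.sqrt (v * y))⁻¹ : ℝ) := by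
  simp [scalingKernel, h]

/-- The value of the kernel on the curve `y = e^{−τ}v`: `k_g(v, e^{−τ}v) = g(τ) e^{τ/2} / |v|`.
[cite: ConnesConsani2021, §4 eq. (40) p. 15] -/
theorem scalingKernel_exp_mul {v : ℝ} (hv : v ≠ 0) (τ : ℝ) :
    scalingKernel g v (Real.exp (-τ) * v) = g τ * ((Real.exp (τ / 2) / |v| : ℝ) : ℂ) := by
  have hpos : 0 < v * (Real.exp (-τ) * v) := by
    have : v * (Real.exp (-τ) * v) = Real.exp (-τ) * v ^ 2 := by ring
    rw [this]; exact mul_pos (Real.exp_pos _) (by positivity)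
  rw [scalingKernel_of_pos hpos]
  have hlog : Real.log (v / (Real.exp (-τ) * v)) = τ := by
    rw [show v / (Real.exp (-τ) * v) = Real.exp τ by
      field_simp; rw [← Real.exp_add, neg_add_cancel, Real.exp_zero]]
    exact Real.log_exp τ
  have hsqrt : Real.sqrt (v * (Real.exp (-τ) * v)) = Real.exp (-τ / 2) * |v| := by
    rw [show v * (Real.exp (-τ) * v) = Real.exp (-τ / 2) ^ 2 * v ^ 2 by
      rw [← Real.exp_nat_mul]; ring_nf, Real.sqrt_mul' _ (sq_nonneg v), Real.sqrt_sq (Real.exp_pos _).le,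
      Real.sqrt_sq_eq_abs]
  rw [hlog, hsqrt, mul_inv, ← Real.exp_neg, neg_div, neg_neg, div_eq_mul_inv (Real.exp (τ / 2)) |v|]

/-- The image of `τ ↦ e^{−τ}v` is the open half-line `{y | vy > 0}` (`v ≠ 0`). [folklore] -/
private theorem image_exp_neg_mul {v : ℝ} (hv : v ≠ 0) :
    (fun τ : ℝ => Real.exp (-τ) * v) '' univ = {y : ℝ | 0 < v * y} := by
  ext y
  simp only [image_univ, mem_range, mem_setOf_eq]
  constructor
  · rintro ⟨τ, rfl⟩
    have : v * (Real.exp (-τ) * v) = Real.exp (-τ) * v ^ 2 := by ring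
    rw [this]; exact mul_pos (Real.exp_pos _) (by positivity)
  · intro h
    have hyv : 0 < y / v := by
      rcases lt_or_gt_of_ne hv with hv' | hv'
      · exact div_pos_of_neg_of_neg (by nlinarith) hv'
      · exact div_pos (by nlinarith) hv'
    refine ⟨-Real.log (y / v), ?_⟩
    rw [neg_neg, Real.exp_log hyv, div_mul_cancel₀ _ hv]

/-- The Jacobian identity of the substitution `y = e^{−τ}v`:
`|d(e^{−τ}v)/dτ| · k_g(v, e^{−τ}v) η(e^{−τ}v) = g(τ) e^{−τ/2} η(e^{−τ}v)`. [cite: ConnesConsani2021, §4 eq. (40) p. 15] -/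
private theorem jacobian_smul_scalingKernel {v : ℝ} (hv : v ≠ 0) (η : ℝ → ℂ) (τ : ℝ) :
    |-Real.exp (-τ) * v| • (scalingKernel g v (Real.exp (-τ) * v) * η (Real.exp (-τ) * v))
      = g τ * ((Real.exp (-τ / 2) : ℂ) * η (Real.exp (-τ) * v)) := by
  have habs : |-Real.exp (-τ) * v| = Real.exp (-τ) * |v| := by
    rw [neg_mul, abs_neg, abs_mul, Real.abs_exp]
  have hvne : |v| ≠ 0 := (abs_pos.mpr hv).ne'
  have hr : Real.exp (-τ) * |v| * (Real.exp (τ / 2) / |v|) = Real.exp (-τ / 2) := by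
    rw [div_eq_mul_inv, mul_mul_mul_comm, mul_inv_cancel₀ hvne, mul_one, ← Real.exp_add]
    congr 1; ring
  rw [scalingKernel_exp_mul hv, habs, Complex.real_smul]
  calc ((Real.exp (-τ) * |v| : ℝ) : ℂ) * (g τ * ((Real.exp (τ / 2) / |v| : ℝ) : ℂ) * η (Real.exp (-τ) * v))
      = g τ * (((Real.exp (-τ) * |v| * (Real.exp (τ / 2) / |v|) : ℝ) : ℂ) * η (Real.exp (-τ) * v)) := by
        push_cast; ring
    _ = g τ * ((Real.exp (-τ / 2) : ℂ) * η (Real.exp (-τ) * v)) := by rw [hr]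

/-- The substitution map `τ ↦ e^{−τ}v` is a diffeomorphism of `ℝ` onto `{y | vy > 0}` (derivative). [folklore] -/
private theorem hasDerivWithinAt_exp_neg_mul (v τ : ℝ) :
    HasDerivWithinAt (fun τ : ℝ => Real.exp (-τ) * v) (-Real.exp (-τ) * v) univ τ := by
  have h := ((Real.hasDerivAt_exp (-τ)).comp τ (hasDerivAt_neg τ)).mul_const v
  exact (by simpa [neg_mul] using h :
    HasDerivAt (fun τ : ℝ => Real.exp (-τ) * v) (-Real.exp (-τ) * v) τ).hasDerivWithinAt

/-- Injectivity of `τ ↦ e^{−τ}v` (`v ≠ 0`). [folklore] -/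
private theorem injOn_exp_neg_mul {v : ℝ} (hv : v ≠ 0) : InjOn (fun τ : ℝ => Real.exp (-τ) * v) univ := by
  intro a _ b _ hab
  have := mul_right_cancel₀ hv hab
  simpa using Real.exp_injective this

/-- **`ϑ(g)` as an integral operator (pointwise change of variables `y = e^{−τ}v`)**: for `v ≠ 0` and
any function `η`,
`∫ k_g(v,y) η(y) dy = ∫ g(τ) e^{−τ/2} η(e^{−τ}v) dτ` — the right-hand side being the integrand of
`ScalingOperator.scalingCoeff` / the pointwise action of `scalingOp g` (`scalingUnitary_coeFn`).
No integrability hypothesis (both sides are junk together). [cite: ConnesConsani2021, §4 eq. (40) p. 15; Prop. 2.2 (iii) proof p. 10 ("`ϑ(f) = ∫ f(ρ⁻¹)ϑ(ρ⁻¹)d*ρ`")] -/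
theorem integral_scalingKernel_mul {v : ℝ} (hv : v ≠ 0) (η : ℝ → ℂ) :
    ∫ y, scalingKernel g v y * η y
      = ∫ τ, g τ * ((Real.exp (-τ / 2) : ℂ) * η (Real.exp (-τ) * v)) := by
  have hcv := integral_image_eq_integral_abs_deriv_smul MeasurableSet.univ
    (fun τ _ => hasDerivWithinAt_exp_neg_mul v τ) (injOn_exp_neg_mul hv)
    (fun y => scalingKernel g v y * η y)
  rw [image_exp_neg_mul hv, setIntegral_univ] at hcv
  -- the left side: the kernel vanishes off `{y | vy > 0}`
  have hL : ∫ y in {y : ℝ | 0 < v * y}, scalingKernel g v y * η y = ∫ y, scalingKernel g v y * η y := by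
    refine setIntegral_eq_integral_of_forall_compl_eq_zero fun y hy => ?_
    rw [scalingKernel_of_not_pos (by simpa using hy), zero_mul]
  rw [← hL, hcv]
  exact integral_congr_ae (ae_of_all _ fun τ => jacobian_smul_scalingKernel hv η τ)

/-- **Integrability transfers along the substitution**: `y ↦ k_g(v,y)η(y)` is integrable iff
`τ ↦ g(τ)e^{−τ/2}η(e^{−τ}v)` is (`v ≠ 0`). [cite: ConnesConsani2021, §4 eq. (40) p. 15] -/
theorem integrable_scalingKernel_mul_iff {v : ℝ} (hv : v ≠ 0) (η : ℝ → ℂ) :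
    Integrable (fun y => scalingKernel g v y * η y)
      ↔ Integrable (fun τ => g τ * ((Real.exp (-τ / 2) : ℂ) * η (Real.exp (-τ) * v))) := by
  have hcv := integrableOn_image_iff_integrableOn_abs_deriv_smul MeasurableSet.univ
    (fun τ _ => hasDerivWithinAt_exp_neg_mul v τ) (injOn_exp_neg_mul hv)
    (fun y => scalingKernel g v y * η y)
  rw [image_exp_neg_mul hv, integrableOn_univ] at hcv
  have hsupp : IntegrableOn (fun y => scalingKernel g v y * η y) {y : ℝ | 0 < v * y} volume
      ↔ Integrable (fun y => scalingKernel g v y * η y) := by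
    refine ⟨fun h => h.integrable_of_forall_notMem_eq_zero fun y hy => ?_, fun h => h.integrableOn⟩
    rw [scalingKernel_of_not_pos (by simpa using hy), zero_mul]
  rw [← hsupp, hcv]
  exact integrable_congr (ae_of_all _ fun τ => jacobian_smul_scalingKernel hv η τ)

/-! ## (k-1b) `ϑ(g)` IS the integral operator with kernel `k_g` (a.e. identification on `L²`) -/

/-- `L¹ ≤ √(measure) · L²` on a set of finite measure, for an `L²` class: `∫_s ‖h‖ ≤ √(vol s) · ‖h‖₂`.
[folklore] -/
private theorem setIntegral_norm_le_sqrt_mul_norm {s : Set ℝ}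
    (hμs : volume s ≠ ⊤) (h : Lp ℂ 2 (volume : Measure ℝ)) :
    ∫ v in s, ‖(h : ℝ → ℂ) v‖ ≤ Real.sqrt (volume s).toReal * ‖h‖ := by
  have hmeas : AEStronglyMeasurable (h : ℝ → ℂ) (volume.restrict s) :=
    (Lp.aestronglyMeasurable h).restrict
  have h1 : ∫ v in s, ‖(h : ℝ → ℂ) v‖ = (eLpNorm (h : ℝ → ℂ) 1 (volume.restrict s)).toReal := by
    rw [integral_norm_eq_lintegral_enorm hmeas, eLpNorm_one_eq_lintegral_enorm]
  have h2 : eLpNorm (h : ℝ → ℂ) 1 (volume.restrict s)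
      ≤ eLpNorm (h : ℝ → ℂ) 2 (volume.restrict s) * volume s ^ (1 / 2 : ℝ) := by
    have := eLpNorm_le_eLpNorm_mul_rpow_measure_univ (p := 1) (q := 2) (by norm_num) hmeas
    norm_num at this
    exact this
  have h3 : eLpNorm (h : ℝ → ℂ) 2 (volume.restrict s) ≤ eLpNorm (h : ℝ → ℂ) 2 volume :=
    eLpNorm_mono_measure _ Measure.restrict_le_self
  have hfin : eLpNorm (h : ℝ → ℂ) 2 volume < ⊤ := Lp.eLpNorm_lt_top h
  rw [h1, Lp.norm_def, Real.sqrt_eq_rpow, ENNReal.toReal_rpow, ← ENNReal.toReal_mul]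
  refine ENNReal.toReal_mono (ENNReal.mul_ne_top
    (ENNReal.rpow_ne_top_of_nonneg (by norm_num) hμs) hfin.ne) ?_
  calc eLpNorm (h : ℝ → ℂ) 1 (volume.restrict s)
      ≤ eLpNorm (h : ℝ → ℂ) 2 (volume.restrict s) * volume s ^ (1 / 2 : ℝ) := h2
    _ ≤ eLpNorm (h : ℝ → ℂ) 2 volume * volume s ^ (1 / 2 : ℝ) := by gcongr
    _ = volume s ^ (1 / 2 : ℝ) * eLpNorm (h : ℝ → ℂ) 2 volume := mul_comm _ _

/-- The two-variable integrand `(τ, v) ↦ g(τ) e^{−τ/2} η(e^{−τ}v)` behind `ϑ(g)η` is integrable on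
`ℝ × s` for `s` of finite measure (`g ∈ C_c`, `η ∈ L²`): the Fubini licence for (k-1b). [folklore] -/
private theorem integrable_scaling_integrand (hg : Continuous g) (hgs : HasCompactSupport g)
    (η : Lp ℂ 2 (volume : Measure ℝ)) {s : Set ℝ} (hμs : volume s ≠ ⊤) :
    Integrable (fun p : ℝ × ℝ => g p.1 * ((Real.exp (-p.1 / 2) : ℂ) * (η : ℝ → ℂ) (Real.exp (-p.1) * p.2)))
      ((volume : Measure ℝ).prod (volume.restrict s)) := by
  set Φ : ℝ × ℝ → ℂ := fun p => g p.1 * ((Real.exp (-p.1 / 2) : ℂ) * (η : ℝ → ℂ) (Real.exp (-p.1) * p.2))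
    with hΦ
  have hηm : Measurable (η : ℝ → ℂ) := (Lp.stronglyMeasurable η).measurable
  have hΦm : Measurable Φ := by
    refine (hg.measurable.comp measurable_fst).mul
      ((Complex.measurable_ofReal.comp ((measurable_fst.neg.div_const 2).exp)).mul
        (hηm.comp ((measurable_fst.neg.exp).mul measurable_snd)))
  rw [integrable_prod_iff hΦm.aestronglyMeasurable]
  constructor
  · -- each slice `v ↦ Φ(τ,v)` is `g τ •` (a representative of) `ϑ(e^τ)η ∈ L²`, integrable on `s`
    refine Filter.Eventually.of_forall fun τ => ?_
    have hU : IntegrableOn (scalingUnitary τ η : ℝ → ℂ) s volume :=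
      integrableOn_Lp_of_measure_ne_top _ (by norm_num) hμs
    have hU' : IntegrableOn (fun v => (Real.exp (-τ / 2) : ℂ) * (η : ℝ → ℂ) (Real.exp (-τ) * v)) s volume :=
      hU.congr_fun_ae (ae_restrict_of_ae (scalingUnitary_coeFn τ η))
    simpa [hΦ] using hU'.const_mul (g τ)
  · -- `τ ↦ ∫_s ‖Φ(τ,v)‖ dv ≤ ‖g τ‖ √(vol s) ‖η‖`, and `g ∈ C_c`
    have hbound : ∀ τ, ∫ v in s, ‖Φ (τ, v)‖ ≤ ‖g τ‖ * (Real.sqrt (volume s).toReal * ‖η‖) := by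
      intro τ
      have hae := scalingUnitary_coeFn τ η
      have heq : ∫ v in s, ‖Φ (τ, v)‖ = ‖g τ‖ * ∫ v in s, ‖(scalingUnitary τ η : ℝ → ℂ) v‖ := by
        rw [← integral_const_mul]
        refine integral_congr_ae ?_
        filter_upwards [ae_restrict_of_ae (s := s) hae] with v hv
        simp only [hΦ, hv, norm_mul]
      rw [heq]
      gcongr
      calc ∫ v in s, ‖(scalingUnitary τ η : ℝ → ℂ) v‖
          ≤ Real.sqrt (volume s).toReal * ‖scalingUnitary τ η‖ :=
            setIntegral_norm_le_sqrt_mul_norm hμs _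
        _ = Real.sqrt (volume s).toReal * ‖η‖ := by rw [norm_scalingUnitary_apply]
    refine Integrable.mono'
      ((hg.norm.integrable_of_hasCompactSupport hgs.norm).mul_const (Real.sqrt (volume s).toReal * ‖η‖))
      hΦm.aestronglyMeasurable.norm.integral_prod_right' ?_
    refine Filter.Eventually.of_forall fun τ => ?_
    rw [Real.norm_eq_abs, abs_of_nonneg (integral_nonneg fun v => norm_nonneg _)]
    exact hbound τ

/-- **(k-1b) `ϑ(g)` is the integral operator with kernel `k_g`** (a.e. on `L²(ℝ)`): for `g ∈ C_c(ℝ)` and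
`η ∈ L²(ℝ)`, `(ϑ(g)η)(v) = ∫ k_g(v,y) η(y) dy` for a.e. `v`.  Proof: both sides have the same integral
over every set `s` of finite measure — `∫_s ϑ(g)η = ⟪1_s, ϑ(g)η⟫ = ∫ g(τ)⟪1_s, ϑ(e^τ)η⟫dτ`
(`inner_scalingOp`) `= ∫ g(τ) ∫_s e^{−τ/2}η(e^{−τ}v) dv dτ`, Fubini (`integrable_scaling_integrand`), and the
change of variables `integral_scalingKernel_mul` pointwise in `v ≠ 0`.
[cite: ConnesConsani2021, §4 eq. (40) p. 15; §1 Lemma 1.1 p. 7 (arXiv Lemma 4); Prop. 2.2 (iii) proof p. 10] -/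
theorem scalingOp_coeFn_eq_integral (hg : Continuous g) (hgs : HasCompactSupport g)
    (η : Lp ℂ 2 (volume : Measure ℝ)) :
    (scalingOp g η : ℝ → ℂ) =ᵐ[volume] fun v => ∫ y, scalingKernel g v y * (η : ℝ → ℂ) y := by
  have hgi : Integrable g := hg.integrable_of_hasCompactSupport hgs
  -- the pointwise `τ`-form of the right-hand side
  set G : ℝ → ℂ := fun v => ∫ τ, g τ * ((Real.exp (-τ / 2) : ℂ) * (η : ℝ → ℂ) (Real.exp (-τ) * v))
    with hG
  have hGK : (fun v => ∫ y, scalingKernel g v y * (η : ℝ → ℂ) y) =ᵐ[volume] G := by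
    filter_upwards [compl_mem_ae_iff.mpr (measure_singleton (0 : ℝ))] with v hv
    have hv0 : v ≠ 0 := fun h => hv (by simp [h])
    exact integral_scalingKernel_mul hv0 _
  refine (ae_eq_of_forall_setIntegral_eq_of_sigmaFinite ?_ ?_ ?_).trans hGK.symm
  · exact fun s _ hμs => integrableOn_Lp_of_measure_ne_top _ (by norm_num) hμs.ne
  · intro s hs hμs
    exact (integrable_scaling_integrand hg hgs η hμs.ne).integral_prod_right
  · intro s hs hμs
    -- `∫_s ϑ(g)η = ⟪1_s, ϑ(g)η⟫ = ∫ g τ ⟪1_s, ϑ(e^τ)η⟫ dτ = ∫ g τ ∫_s e^{-τ/2} η(e^{-τ}v) dv dτ`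
    have h1 : ∫ v in s, (scalingOp g η : ℝ → ℂ) v
        = ∫ τ, g τ * scalingCoeff (indicatorConstLp 2 hs hμs.ne (1 : ℂ)) η τ := by
      rw [← L2.inner_indicatorConstLp_one hs hμs.ne (scalingOp g η), inner_scalingOp hgi]
    have h2 : ∀ τ, scalingCoeff (indicatorConstLp 2 hs hμs.ne (1 : ℂ) : ℝ → ℂ) η τ
        = ∫ v in s, (Real.exp (-τ / 2) : ℂ) * (η : ℝ → ℂ) (Real.exp (-τ) * v) := by
      intro τ
      rw [scalingCoeff, ← integral_indicator hs]
      refine integral_congr_ae ?_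
      filter_upwards [indicatorConstLp_coeFn (p := (2 : ENNReal)) (hs := hs) (hμs := hμs.ne)
        (c := (1 : ℂ))] with v hv
      rw [hv]
      by_cases hvs : v ∈ s
      · simp [Set.indicator_of_mem hvs]
      · simp [Set.indicator_of_notMem hvs]
    rw [h1]
    simp_rw [h2, ← integral_const_mul]
    -- Fubini
    have hF : Integrable (Function.uncurry fun (τ : ℝ) (v : ℝ) =>
        g τ * ((Real.exp (-τ / 2) : ℂ) * (η : ℝ → ℂ) (Real.exp (-τ) * v)))
        ((volume : Measure ℝ).prod (volume.restrict s)) :=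
      integrable_scaling_integrand hg hgs η hμs.ne
    rw [integral_integral_swap hF]


/-- For a.e. `v`, the kernel slice `y ↦ k_g(v,y) η(y)` is integrable (`g ∈ C_c`, `η ∈ L²`): from the
Fubini licence of (k-1b) on `ℝ × s` for every `s` of finite measure, transferred along `y = e^{−τ}v`.
[cite: ConnesConsani2021, §4 eq. (40) p. 15] -/
theorem ae_integrable_scalingKernel_mul (hg : Continuous g) (hgs : HasCompactSupport g)
    (η : Lp ℂ 2 (volume : Measure ℝ)) :
    ∀ᵐ v ∂(volume : Measure ℝ), Integrable (fun y => scalingKernel g v y * (η : ℝ → ℂ) y) := by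
  refine ae_of_forall_measure_lt_top_ae_restrict _ fun s _ hμs => ?_
  have hF := (integrable_scaling_integrand hg hgs η hμs.ne).swap
  have hae : ∀ᵐ v ∂(volume.restrict s), Integrable
      (fun τ => g τ * ((Real.exp (-τ / 2) : ℂ) * (η : ℝ → ℂ) (Real.exp (-τ) * v))) volume := by
    simpa using hF.prod_right_ae
  have h0 : ∀ᵐ v ∂(volume.restrict s), v ≠ 0 :=
    ae_restrict_of_ae (by
      filter_upwards [compl_mem_ae_iff.mpr (measure_singleton (0 : ℝ))] with v hv
      exact fun h => hv (by simp [h]))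
  filter_upwards [hae, h0] with v hv hv0
  exact (integrable_scalingKernel_mul_iff hv0 _).mpr hv

/-! ## (k-2a) The symmetrised kernel: `½((ϑ(g)η)(x) + (ϑ(g)η)(−x)) = ∫ ½ g(log|x| − log|y|) |xy|^{−1/2} η(y) dy` -/

/-- The symmetrised (even-part) kernel `k_g^{ev}(x,y) := ½ (k_g(x,y) + k_g(−x,y))` — the kernel of
`E ∘ ϑ(g)`, `E` the projection onto even functions (plan step k-2; CC work on `L²(ℝ)_ev`, Remark 1.2).
[cite: ConnesConsani2021, §1 Remark 1.2 p. 7 (arXiv Remark 5); §4 eq. (40) p. 15] -/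
def evenScalingKernel (g : ℝ → ℂ) (x y : ℝ) : ℂ :=
  (1 / 2 : ℂ) * (scalingKernel g x y + scalingKernel g (-x) y)

/-- Closed form of the symmetrised kernel off the axes: `k_g^{ev}(x,y) = ½ g(log(|x|/|y|)) |xy|^{−1/2}`
(exactly one of `xy > 0`, `(−x)y > 0` holds). [cite: ConnesConsani2021, §1 Remark 1.2 p. 7 (arXiv Remark 5)] -/
theorem evenScalingKernel_eq {x y : ℝ} (hx : x ≠ 0) (hy : y ≠ 0) :
    evenScalingKernel g x y
      = (1 / 2 : ℂ) * (g (Real.log (|x| / |y|)) * ((Real.sqrt (|x| * |y|))⁻¹ : ℝ)) := by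
  unfold evenScalingKernel
  congr 1
  rcases lt_or_gt_of_ne (mul_ne_zero hx hy) with hneg | hpos
  · -- `xy < 0`: the second kernel is active
    have h1 : ¬ 0 < x * y := not_lt.mpr hneg.le
    have h2 : 0 < -x * y := by linarith
    rw [scalingKernel_of_not_pos h1, zero_add, scalingKernel_of_pos h2]
    have hxy : |x| / |y| = -x / y := by
      rcases lt_trichotomy x 0 with hx' | hx' | hx'
      · have hy' : 0 < y := by nlinarith
        rw [abs_of_neg hx', abs_of_pos hy']
      · exact absurd hx' hx
      · have hy' : y < 0 := by nlinarith
        rw [abs_of_pos hx', abs_of_neg hy']; ring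
    have hxy' : |x| * |y| = -x * y := by rw [← abs_mul, abs_of_neg hneg]; ring
    rw [hxy, hxy']
  · -- `xy > 0`: the first kernel is active
    have h2 : ¬ 0 < -x * y := by rw [neg_mul]; exact not_lt.mpr (neg_nonpos.mpr hpos.le)
    rw [scalingKernel_of_pos hpos, scalingKernel_of_not_pos h2, add_zero]
    have hxy : |x| / |y| = x / y := by
      rcases lt_trichotomy x 0 with hx' | hx' | hx'
      · have hy' : y < 0 := by nlinarith
        rw [abs_of_neg hx', abs_of_neg hy', neg_div_neg_eq]
      · exact absurd hx' hx
      · have hy' : 0 < y := by nlinarith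
        rw [abs_of_pos hx', abs_of_pos hy']
    rw [hxy, ← abs_mul, abs_of_pos hpos]

/-- **(k-2a) The even part of `ϑ(g)η` is the integral operator with the symmetrised kernel** (a.e.):
`½((ϑ(g)η)(x) + (ϑ(g)η)(−x)) = ∫ k_g^{ev}(x,y) η(y) dy`.  With the even projection `E`,
`(Eu)(x) = ½(u(x) + u(−x))`, this is the kernel of `E ∘ ϑ(g)`; multiplied by `1_{|x| ≥ 1}` it is the
kernel `K₁` of `𝐏₁₀ ∘ ϑ(g)` of the plan (`cc/drafts/t1-prop22iii-PLAN.md` §1).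
[cite: ConnesConsani2021, §1 Remark 1.2 p. 7 (arXiv Remark 5); Prop. 2.2 (iii) proof p. 10] -/
theorem scalingOp_coeFn_even_part (hg : Continuous g) (hgs : HasCompactSupport g)
    (η : Lp ℂ 2 (volume : Measure ℝ)) :
    (fun x => (1 / 2 : ℂ) * ((scalingOp g η : ℝ → ℂ) x + (scalingOp g η : ℝ → ℂ) (-x)))
      =ᵐ[volume] fun x => ∫ y, evenScalingKernel g x y * (η : ℝ → ℂ) y := by
  have h := scalingOp_coeFn_eq_integral hg hgs η
  have hneg : (fun x => (scalingOp g η : ℝ → ℂ) (-x))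
      =ᵐ[volume] fun x => ∫ y, scalingKernel g (-x) y * (η : ℝ → ℂ) y :=
    (Measure.measurePreserving_neg (volume : Measure ℝ)).quasiMeasurePreserving.ae_eq_comp h
  -- integrability of the two kernel slices, for a.e. `x`, to split the integral of the sum
  have hint : ∀ᵐ x ∂(volume : Measure ℝ), Integrable (fun y => scalingKernel g x y * (η : ℝ → ℂ) y) :=
    ae_integrable_scalingKernel_mul hg hgs η
  have hint' : ∀ᵐ x ∂(volume : Measure ℝ), Integrable (fun y => scalingKernel g (-x) y * (η : ℝ → ℂ) y) :=
    (Measure.measurePreserving_neg (volume : Measure ℝ)).quasiMeasurePreserving.ae hint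
  filter_upwards [h, hneg, hint, hint'] with x hx hxn hi1 hi2
  rw [hx, hxn, ← integral_add hi1 hi2, ← integral_const_mul]
  refine integral_congr_ae (ae_of_all _ fun y => ?_)
  simp only [evenScalingKernel]
  ring

end Literature.NumberTheory.ConnesConsani2021

end
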